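/-
Copyright: cell pub-balaban-gaps (YM BLITZ Y1, track G1), seat g1-p2 GEN 10 (unit `pub-balaban-gaps-g1-p2`).  Row (D4) NODE O,
the PER-CUBE (3.35) DICTIONARY: `D4WalkBlockReg335Dictionary` unpacked lit-balaban's `Reg335Cube` only for the cube `□ = univ` (ONE
global gauge); print's class `Reg335` is a family of cubes, each with ITS OWN gauge `u_□` ON `□`.  Here: for an arbitrary cube `□ ⊆ S`
the gauge is extended by `1` outside `□` to a GLOBAL site gauge (two-sided inverses everywhere, `‖·‖ ≤ 1` on `□`, `= 1` off `□`), with the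
gauge relations `g(y)U_μ(y)g⁻(T_μy) = exp(X_μ y)` and the windows ON THE BONDS OF `□`; torus ∕ matrix version with row sums `≤ 1`
everywhere (so `fibD g` is exactly a per-cube CONJUGATOR of `D4WalkBlockLocalInverseGauge` ∕ `D4WalkModelGaugedSchur`); and the family
version over lit-balaban's `Reg335 T U η L 𝒬 C`.  HONEST FRAMING: bookkeeping between typed hypothesis shapes; nothing of Bałaban's
asserted; (D4) instance 0∕1; NOT BetaPertH, NOT continuum, NOT Clay.
-/
import Summits.QuantumFields.BalabanUV.Gaps.D4WalkBlockReg335Dictionary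

/-!
# `Gaps.D4WalkBlockReg335CubeDictionary` — `Reg335Cube` on an arbitrary cube ⟹ a global site gauge, small field ON the cube
# (cell pub-balaban-gaps, seat g1-p2 gen 10)

HONEST DEPENDENCY (cell pub-balaban, verbatim): continuum YM on T⁴ ⇐ BetaPertH ∧ nine spine estimates (0/9 proved);
BetaPertH ⇐ (D1) ∧ (D4) ∧ CAP+tail.

* §1 (generic `𝔸`, `S`, `T`) **`gauge_data_of_reg335Cube_on`**: `Reg335Cube T U η □ ξ C` ⟹ ∃ `g g⁻ : S → 𝔸`, `X : ι → S → 𝔸`: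
  `gg⁻ = g⁻g = 1` everywhere, `g = g⁻ = 1` off `□`, `‖g‖, ‖g⁻‖ ≤ 1` on `□`, and for every bond of `□` (`y, T_μ y ∈ □`):
  `g(y)U_μ(y)g⁻(T_μy) = exp (X_μ y)`, `g(T_μy)U_μ(y)⁻¹g⁻(y) = exp (−X_μ y)`, `‖X_μ y‖ ≤ |η|Cξ⁻¹`; and `‖X_μ x − X_μ(T_μ⁻¹x)‖ ≤ |η|²Cξ⁻²`
  whenever `x, T_μ⁻¹x ∈ □`.  **`gauge_data_of_reg335`**: the same for every cube of lit-balaban's class `Reg335 T U η L 𝒬 C` at its scale.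
* §2 (torus, matrices in the `ℓ^∞`-operator norm) **`gaugeHyps_of_reg335Cube_on_torus`**: row sums of `g`, `g⁻` at most `1` EVERYWHERE
  (identity off `□`), the relations and row-sum windows on `□`'s bonds.
Consumers: the per-cube conjugators of `D4WalkBlockLocalInverseGauge{,End,Schur}` ∕ `D4WalkModelGaugedSchur` (`fibD g`).
WHAT IT IS NOT.  The Schur budget of (3.52)–(3.54)'s `V′` on `□̃ ⊆ □` from these windows; (D4) instance 0∕1; words of row (D4) UNCHANGED.

References: T. Bałaban, Comm. Math. Phys. **99** (1985) 389–434 [B9], (3.28) p. 395, (3.35)–(3.37) p. 396, Cor. 3.6 p. 408.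
-/

noncomputable section

namespace Summit.QuantumFields.BalabanUV.Gaps.D4WalkBlockReg335CubeDictionary

open Complex NormedSpace
open scoped Matrix
open Literature.MathematicalPhysics.QuantumFieldTheory.Balaban1983to89
open Literature.MathematicalPhysics.QuantumFieldTheory.Balaban1983to89.B9Eq39Adjoint (R covD fluct)
open Literature.MathematicalPhysics.QuantumFieldTheory.Balaban1983to89.B9Eq3117Current (gaugeTr)
open Literature.MathematicalPhysics.QuantumFieldTheory.Balaban1983to89.B9Eq335RegularityClasses (Reg335Cube Reg335)
open Literature.MathematicalPhysics.QuantumFieldTheory.Balaban1983to89.LatticeNorms (scaleLen)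
open Literature.MathematicalPhysics.QuantumFieldTheory.Balaban1983to89.B9Eq369Product (val_fluct val_inv_fluct)
open Literature.MathematicalPhysics.QuantumFieldTheory.Balaban1983to89.B4Reflection242 (boxDom)
open Literature.MathematicalPhysics.QuantumFieldTheory.Balaban1983to89.B6MultiLevelBoxOperator (N0)
open Literature.MathematicalPhysics.QuantumFieldTheory.Balaban1983to89.B6MultiLevelTorusOperator (tshift unitVec)
open Summit.QuantumFields.BalabanUV.Gaps.D4WalkBlockTransportAlgebra (rowSumNorm)
open Summit.QuantumFields.BalabanUV.Gaps.D4WalkBlockExpWindow (rowSumNorm_le_norm)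
open Summit.QuantumFields.BalabanUV.Gaps.D4WalkBlockReg335Dictionary (val_gaugeTr)

/-! ## §1. Generic: (3.35) on a cube, the gauge extended by the identity -/

section Generic

variable {𝔸 : Type*} [NormedRing 𝔸] [NormedAlgebra ℂ 𝔸] [CompleteSpace 𝔸] {S : Type*} {ι : Type*} [Fintype ι] [LinearOrder ι]
variable (T : ι → Equiv.Perm S) (U : ι → S → 𝔸ˣ)

omit [Fintype ι] [LinearOrder ι] in
/-- **(3.35) ON A CUBE `□`, UNPACKED WITH A GLOBAL GAUGE**: the gauge `u` of `Reg335Cube T U η □ ξ C` extended by `1` outside `□`.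
[cite: Balaban1985BackgroundPropagators, (3.35) p.396, (3.28) p.395, Cor. 3.6 p.408] -/
theorem gauge_data_of_reg335Cube_on (cube : Set S) [DecidablePred (· ∈ cube)] {η ξ C : ℝ} (hη : η ≠ 0)
    (h : Reg335Cube T U η cube ξ C) :
    ∃ (g gi : S → 𝔸) (X : ι → S → 𝔸),
      (∀ x, g x * gi x = 1) ∧ (∀ x, gi x * g x = 1) ∧ (∀ x, x ∉ cube → g x = 1 ∧ gi x = 1) ∧
      (∀ x ∈ cube, ‖g x‖ ≤ 1 ∧ ‖gi x‖ ≤ 1) ∧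
      (∀ μ, ∀ y ∈ cube, T μ y ∈ cube → g y * (U μ y : 𝔸) * gi (T μ y) = exp (X μ y)) ∧
      (∀ μ, ∀ y ∈ cube, T μ y ∈ cube → g (T μ y) * (((U μ y)⁻¹ : 𝔸ˣ) : 𝔸) * gi y = exp (-X μ y)) ∧
      (∀ μ, ∀ y ∈ cube, ‖X μ y‖ ≤ |η| * C * ξ⁻¹) ∧
      (∀ μ x, x ∈ cube → (T μ).symm x ∈ cube → ‖X μ x - X μ ((T μ).symm x)‖ ≤ |η| ^ 2 * C * (ξ ^ 2)⁻¹) := by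
  obtain ⟨u, A, hu, hg, hA, hD⟩ := h
  let v : S → 𝔸ˣ := fun x => if x ∈ cube then u x else 1
  have hv_in : ∀ x ∈ cube, v x = u x := fun x hx => by simp [v, hx]
  have hv_out : ∀ x, x ∉ cube → v x = 1 := fun x hx => by simp [v, hx]
  refine ⟨fun x => (v x : 𝔸), fun x => (((v x)⁻¹ : 𝔸ˣ) : 𝔸), fun μ y => ((I * η : ℂ)) • A μ y, fun x => Units.mul_inv _,
    fun x => Units.inv_mul _, fun x hx => ?_, fun x hx => ?_, fun μ y hy hTy => ?_, fun μ y hy hTy => ?_, fun μ y hy => ?_,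
    fun μ x hx hTx => ?_⟩
  · simp [hv_out x hx]
  · dsimp only
    rw [hv_in x hx]; exact hu x hx
  · have e := congrArg (fun w : 𝔸ˣ => (w : 𝔸)) (hg μ y hy)
    simp only [val_gaugeTr, val_fluct] at e
    dsimp only
    rw [hv_in y hy, hv_in _ hTy]
    exact e
  · have e := congrArg (fun w : 𝔸ˣ => (((w⁻¹ : 𝔸ˣ)) : 𝔸)) (hg μ y hy)
    simp only [gaugeTr, mul_inv_rev, inv_inv, Units.val_mul, val_inv_fluct] at e
    dsimp only
    rw [hv_in y hy, hv_in _ hTy]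
    simpa only [mul_assoc] using e
  · have h1 := (hA μ y hy).le
    dsimp only
    calc ‖((I * η : ℂ)) • A μ y‖ ≤ ‖((I * η : ℂ))‖ * ‖A μ y‖ := norm_smul_le _ _
      _ = |η| * ‖A μ y‖ := by simp
      _ ≤ |η| * (C * ξ⁻¹) := mul_le_mul_of_nonneg_left h1 (abs_nonneg η)
      _ = |η| * C * ξ⁻¹ := by ring
  · have h1 := (hD μ μ ((T μ).symm x) hTx).le
    have ecov : covD T (fun _ _ => (1 : 𝔸ˣ)) μ (A μ) ((T μ).symm x) = A μ x - A μ ((T μ).symm x) := by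
      simp [covD]
    rw [ecov] at h1
    have hη' : ‖((η : ℂ))⁻¹‖ = |η|⁻¹ := by simp
    have h2 : ‖A μ x - A μ ((T μ).symm x)‖ ≤ |η| * (C * (ξ ^ 2)⁻¹) := by
      have h3 : ‖((η : ℂ))⁻¹ • (A μ x - A μ ((T μ).symm x))‖ = |η|⁻¹ * ‖A μ x - A μ ((T μ).symm x)‖ := by
        rw [norm_smul, hη']
      rw [h3] at h1
      rwa [inv_mul_le_iff₀ (abs_pos.2 hη)] at h1
    dsimp only
    calc ‖((I * η : ℂ)) • A μ x - ((I * η : ℂ)) • A μ ((T μ).symm x)‖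
        = ‖((I * η : ℂ)) • (A μ x - A μ ((T μ).symm x))‖ := by rw [smul_sub]
      _ ≤ ‖((I * η : ℂ))‖ * ‖A μ x - A μ ((T μ).symm x)‖ := norm_smul_le _ _
      _ = |η| * ‖A μ x - A μ ((T μ).symm x)‖ := by simp
      _ ≤ |η| * (|η| * (C * (ξ ^ 2)⁻¹)) := mul_le_mul_of_nonneg_left h2 (abs_nonneg η)
      _ = |η| ^ 2 * C * (ξ ^ 2)⁻¹ := by ring

omit [Fintype ι] [LinearOrder ι] in
/-- **THE CLASS (3.35)**: for every cube `□` of index `j` in lit-balaban's family `𝒬`, the data of `gauge_data_of_reg335Cube_on` at the scale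
`ξ = scaleLen L η j` — ONE GAUGE PER CUBE. [cite: Balaban1985BackgroundPropagators, (3.35) p.396, Cor. 3.6 p.408] -/
theorem gauge_data_of_reg335 [∀ c : Set S, DecidablePred (· ∈ c)] {η L C : ℝ} {𝒬 : Set (Set S × ℕ)} (hη : η ≠ 0)
    (h : Reg335 T U η L 𝒬 C) :
    ∀ q ∈ 𝒬, ∃ (g gi : S → 𝔸) (X : ι → S → 𝔸),
      (∀ x, g x * gi x = 1) ∧ (∀ x, gi x * g x = 1) ∧ (∀ x, x ∉ q.1 → g x = 1 ∧ gi x = 1) ∧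
      (∀ x ∈ q.1, ‖g x‖ ≤ 1 ∧ ‖gi x‖ ≤ 1) ∧
      (∀ μ, ∀ y ∈ q.1, T μ y ∈ q.1 → g y * (U μ y : 𝔸) * gi (T μ y) = exp (X μ y)) ∧
      (∀ μ, ∀ y ∈ q.1, T μ y ∈ q.1 → g (T μ y) * (((U μ y)⁻¹ : 𝔸ˣ) : 𝔸) * gi y = exp (-X μ y)) ∧
      (∀ μ, ∀ y ∈ q.1, ‖X μ y‖ ≤ |η| * C * (scaleLen L η q.2)⁻¹) ∧
      (∀ μ x, x ∈ q.1 → (T μ).symm x ∈ q.1 → ‖X μ x - X μ ((T μ).symm x)‖ ≤ |η| ^ 2 * C * ((scaleLen L η q.2) ^ 2)⁻¹) :=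
  fun q hq => gauge_data_of_reg335Cube_on T U q.1 hη (h q hq)

end Generic

/-! ## §2. The torus box with matrices in the `ℓ^∞`-operator norm: row sums `≤ 1` everywhere -/

section Torus

open scoped Matrix.Norms.Operator

variable {d N : ℕ} {ℓ Mh k : ℕ} {P : Fin (d + 1) → ℕ}

/-- row sums of the identity matrix are at most `1`. -/
theorem rowSumNorm_one_le (a : Fin N) : rowSumNorm (1 : Matrix (Fin N) (Fin N) ℂ) a ≤ 1 := by
  unfold rowSumNorm
  rw [Finset.sum_eq_single a (fun c _ hc => by rw [Matrix.one_apply_ne (Ne.symm hc), norm_zero])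
    (fun h => (h (Finset.mem_univ a)).elim), Matrix.one_apply_eq, norm_one]

/-- **PER-CUBE GAUGE HYPOTHESES ON THE TORUS** (matrices, `ℓ^∞`-operator norm): from `Reg335Cube` on a cube `□` of the torus box a
GLOBAL site gauge `g`, `g⁻` — two-sided inverses, row sums `≤ 1` EVERYWHERE (identity off `□`) — with the gauge relations and the row-sum
windows on the bonds of `□`.  Exactly the per-cube conjugator datum (`fibD g`) of the local-inverse chain 103–106.
[cite: Balaban1985BackgroundPropagators, (3.35) p.396, Cor. 3.6 p.408, p.409] -/
theorem gaugeHyps_of_reg335Cube_on_torus (U : Fin (d + 1) → ↥(boxDom (N0 ℓ Mh k P)) → (Matrix (Fin N) (Fin N) ℂ)ˣ)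
    (cube : Set ↥(boxDom (N0 ℓ Mh k P))) [DecidablePred (· ∈ cube)] {η ξ C : ℝ} (hη : η ≠ 0)
    (h : Reg335Cube (fun ν => tshift (N0 ℓ Mh k P) (unitVec ν)) U η cube ξ C) :
    ∃ (g gi : ↥(boxDom (N0 ℓ Mh k P)) → Matrix (Fin N) (Fin N) ℂ) (X : Fin (d + 1) → ↥(boxDom (N0 ℓ Mh k P)) → Matrix (Fin N) (Fin N) ℂ),
      (∀ x, g x * gi x = 1) ∧ (∀ x, gi x * g x = 1) ∧ (∀ x a, ∑ b, ‖gi x a b‖ ≤ 1) ∧ (∀ x a, ∑ b, ‖g x a b‖ ≤ 1) ∧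
      (∀ x, x ∉ cube → g x = 1 ∧ gi x = 1) ∧
      (∀ ν, ∀ y ∈ cube, (tshift (N0 ℓ Mh k P) (unitVec ν)) y ∈ cube →
        g y * (U ν y : Matrix (Fin N) (Fin N) ℂ) * gi ((tshift (N0 ℓ Mh k P) (unitVec ν)) y) = exp (X ν y)) ∧
      (∀ ν, ∀ y ∈ cube, (tshift (N0 ℓ Mh k P) (unitVec ν)) y ∈ cube →
        g ((tshift (N0 ℓ Mh k P) (unitVec ν)) y) * (((U ν y)⁻¹ : (Matrix (Fin N) (Fin N) ℂ)ˣ) : Matrix (Fin N) (Fin N) ℂ) * gi y =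
          exp (-X ν y)) ∧
      (∀ ν, ∀ y ∈ cube, ∀ a, rowSumNorm (X ν y) a ≤ |η| * C * ξ⁻¹) ∧
      (∀ ν x, x ∈ cube → (tshift (N0 ℓ Mh k P) (unitVec ν)).symm x ∈ cube → ∀ a,
        rowSumNorm (X ν x - X ν ((tshift (N0 ℓ Mh k P) (unitVec ν)).symm x)) a ≤ |η| ^ 2 * C * (ξ ^ 2)⁻¹) := by
  obtain ⟨g, gi, X, hg, hgi, hout, hnorm, hrel, hreli, hX0, hX1⟩ := gauge_data_of_reg335Cube_on _ U cube hη h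
  refine ⟨g, gi, X, hg, hgi, fun x a => ?_, fun x a => ?_, hout, hrel, hreli, fun ν y hy a => (rowSumNorm_le_norm _ a).trans (hX0 ν y hy),
    fun ν x hx hTx a => (rowSumNorm_le_norm _ a).trans (hX1 ν x hx hTx)⟩
  · by_cases hx : x ∈ cube
    · exact (rowSumNorm_le_norm (gi x) a).trans (hnorm x hx).2
    · rw [(hout x hx).2]; exact rowSumNorm_one_le a
  · by_cases hx : x ∈ cube
    · exact (rowSumNorm_le_norm (g x) a).trans (hnorm x hx).1
    · rw [(hout x hx).1]; exact rowSumNorm_one_le a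

end Torus

end Summit.QuantumFields.BalabanUV.Gaps.D4WalkBlockReg335CubeDictionary

end
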